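import Literature.AlgebraicGeometry.HodgeTheory.AlgebraicClassesCup
import Literature.AlgebraicGeometry.HodgeTheory.SupportedHodgeClassesAlgebraic
import Literature.AlgebraicGeometry.HodgeTheory.AlgebraicClassesHodgeTypeHolds
import Literature.AlgebraicGeometry.HodgeTheory.HodgeTypeExteriorProduct
import Literature.AlgebraicGeometry.HodgeTheory.SaitoGrFDeRhamCurveNetHolds
import Literature.AlgebraicGeometry.HodgeTheory.LefschetzOneOneHolds
import Literature.AlgebraicGeometry.HodgeTheory.SupportedClassesRationalProofs
import Literature.AlgebraicGeometry.HodgeTheory.GysinFormalismCorrespondences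
import Literature.AlgebraicGeometry.Resolution.ProjectiveResolutionProofs
import Literature.AlgebraicGeometry.Motives.ComplexPointsOrientation
import Literature.NumberTheory.Transcendental.DeRhamTheoremMultiplicative
import HarnessLib

/-!
# `Nˡ H²ˡ ∪ N¹ H² ⊆ Nˡ⁺¹ H²ˡ⁺²` on EVERY smooth projective complex variety — the divisor case of Voisin II Prop. 9.20 on the coniveau carrier, unconditionally

Family `hodge`, layer `Literature/AlgebraicGeometry/HodgeTheory`. C. Voisin, *Hodge Theory and
Complex Algebraic Geometry II* (2003), §9.2.4 Prop. 9.20 ("`cl(Z · Z') = cl(Z) ∪ cl(Z')`") read on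
the tree's carrier `algebraicClasses X p = Nᵖ H²ᵖ(X(ℂ); ℂ)` is the multiplicativity
`Nˡ H²ˡ ∪ Nᵏ H²ᵏ ⊆ Nˡ⁺ᵏ H²ˡ⁺²ᵏ` — the named fact `Voisin2003_cupProduct_algebraicClasses`
(`MotivatedClassesAssembly`), whose general case is Chow's moving lemma on real carriers (reduced by
the tree to the cone step, `MovingLemmaExcessInduction`). This file PROVES, with no moving lemma, the
bidegrees with `min(l, k) ≤ 1` on every smooth projective complex `X` — in particular the DIVISOR
case (cycle) × (divisor), previously available in the tree only on abelian varieties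
(`AlgebraicClassesCupAbelianVariety`, by a general translate), on `ℙᴺ` (`AmbientClassesMoving`), for
the hyperplane class (`LefschetzOperatorAlgebraicClasses`, `HyperplaneClassLefschetzOperator`), or
modulo a hypersurface-section hypothesis (`AlgebraicClassesCupDivisor`).

The argument is C. Voisin, *The generalized Hodge and Bloch conjectures are equivalent for general
complete intersections*, Ann. Sci. ÉNS 46 (2013), proof of Lemma 2.1 ("if we have a codimension `k`
cycle `Z ⊂ X`, whose cohomology class `[Z] ∈ H²ᵏ(X, ℚ)` vanishes on the open set `X ∖ Y`, where
`codim Y ≥ k − 1`, then […] `[Z] = Σᵢ j̃ᵢ*αᵢ` […] the classes `αᵢ` are cycle classes on `Ỹᵢ` by the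
Lefschetz theorem on `(1,1)`-classes"), which the tree has as the theorem
`mem_algebraicClasses_of_mem_supportedClasses_of_isOfHodgeType` (`SupportedHodgeClassesAlgebraic`)
over five named facts ALL DISCHARGED since: Deligne's Cor. 8.2.8
(`Deligne1974_ker_restrictCompl_eq_iSup_range_complexGysin_holds`), the semisimplicity lift
(`Voisin2025_hodgeClass_lift_complexGysin_holds`), the support property of Gysin maps
(`gysinMap_restrictCompl_eq_zero_of_field ℂ`), projective Hironaka
(`Resolution.Hironaka1964_projective_holds`) and Lefschetz `(1,1)` (`lefschetzOneOne_rational_holds`).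
Applied to a product: for RATIONAL `a` dying off a closed `Z` of codimension `≥ l` and RATIONAL `b`
dying off a closed `W` of codimension `≥ k`, the class `a ∪ b` is rational (`IsRationalClass.cup`),
of Hodge type `(l + k, l + k)` (algebraic classes are Hodge classes,
`isOfHodgeType_of_mem_algebraicClasses_of_isSmoothProjective`, and the cup product respects the
bigrading, `cupPreservesHodgeType_of_multiplicative_deRham` with de Rham's theorem
`exists_deRhamIsoFamily_holds`), and dies off `Z ∩ W` (cup product with supports,
`restrictCompl_cupProduct_eq_zero`, Fulton §19.2), a closed set of codimension `≥ max(l, k)`; when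
`max(l, k) ≥ l + k − 1`, i.e. `min(l, k) ≤ 1`, Voisin's lemma makes it algebraic of codimension
`l + k`. The coniveau spaces being the complex spans of their rational classes
(`span_isRationalClass_eq_top_of_isSmoothProjective_holds`, `ker_restrictCompl_le_span`), bilinearity
finishes.

* `cupProduct_mem_algebraicClasses_of_isRationalClass_of_inter` — the rational core, for any `l`,
  `k` and any `p ≤ codim (Z ∩ W)` with `l + k = p + 1`;
* `cupProduct_mem_algebraicClasses_of_le_max` — **`Nˡ H²ˡ ∪ Nᵏ H²ᵏ ⊆ Nᵖ⁺¹ H²ᵖ⁺²` whenever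
  `l + k = p + 1` and `p ≤ max(l, k)`** (all complex classes);
* `cupProduct_mem_algebraicClasses_one_right`, `cupProduct_mem_algebraicClasses_one_left` — the
  divisor cases `Nˡ ∪ N¹ ⊆ Nˡ⁺¹`, `N¹ ∪ Nᵏ ⊆ N¹⁺ᵏ` (Voisin II Prop. 9.20 for a cycle and a divisor);
* `lefschetzOperator_mem_algebraicClasses_of_mem` — the Lefschetz operator of ANY class
  `h ∈ N¹ H²(X(ℂ); ℂ)` maps `Nˡ H²ˡ` into `Nˡ⁺¹ H²ˡ⁺²` (the field
  `HardLefschetzNFold.lefschetzOperator_mem_algebraicClasses` for every divisor class, not only the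
  hyperplane class), and `lefschetzPow_mem_supportedClasses_of_mem` — its iterates `Lʲ : Nˡ → Nˡ⁺ʲ`.

What remains of `Voisin2003_cupProduct_algebraicClasses` after this file is exactly the range
`2 ≤ l`, `2 ≤ k`, `l + k < dim X` (`AlgebraicClassesCupOffRange` covers `l + k ≥ dim X`).
Theorems only; no definition, no named fact (D-0026).

## References

* [VoisinHodgeII2003] C. Voisin, Hodge Theory and Complex Algebraic Geometry II (CUP 2003), §9.2.4
  Prop. 9.20 (PDF p. 236), proof of Lemma 9.18.
* [Voisin2013GHCBloch] C. Voisin, The generalized Hodge and Bloch conjectures are equivalent for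
  general complete intersections, Ann. Sci. ÉNS 46 (2013), Lemma 2.1 (proof), arXiv:1107.2600 p. 6.
* [Fulton1998] W. Fulton, Intersection Theory, 2nd ed. (1998), §19.2 Cor. 19.2 (cup product with
  supports; `cl` is a ring homomorphism).
* [GrothendieckTopology1969] A. Grothendieck, Hodge's general conjecture is false for trivial
  reasons, Topology 8 (1969), §1, pp. 299–300.
-/

noncomputable section

open CategoryTheory
open Literature.AlgebraicTopology.SingularHomology Literature.Geometry.Kaehler

namespace Literature.AlgebraicGeometry.HodgeTheory

section HodgeTheory

variable {n : ℕ} {X : Motives.SchemeOver ℂ}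

/-! ### The rational core: Voisin 2013, proof of Lemma 2.1, applied to a cup product -/

/-- **A product of rational supported classes is algebraic as soon as its support has codimension
`≥ (degree / 2) − 1`** (Voisin 2013, proof of Lemma 2.1, for the class `a ∪ b`). Let `X` be smooth
projective of dimension `n` over `ℂ`, `a ∈ H²ˡ(X(ℂ); ℂ)` RATIONAL dying on `(X ∖ Z)(ℂ)` with `Z` closed
of codimension `≥ l`, `b ∈ H²ᵏ(X(ℂ); ℂ)` RATIONAL dying on `(X ∖ W)(ℂ)` with `W` closed of codimension
`≥ k`, and `p` with `l + k = p + 1` such that every point of `Z ∩ W` has codimension `≥ p`. Then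
`a ∪ b ∈ Nᵖ⁺¹ H²ᵖ⁺²(X(ℂ); ℂ) = algebraicClasses X (p + 1)`: `a ∪ b` is rational (`IsRationalClass.cup`),
of Hodge type `(p + 1, p + 1)` (`a`, `b` are algebraic hence Hodge classes, and `∪` respects the
bigrading), and dies off `Z ∩ W` (cup product with supports), so Voisin's lemma
(`mem_algebraicClasses_of_mem_supportedClasses_of_isOfHodgeType`, all of whose named-fact inputs are
theorems of the tree) applies. [cite: Voisin2013GHCBloch, Lemma 2.1 (proof)]
[cite: VoisinHodgeII2003, §9.2.4 Prop. 9.20] [cite: Fulton1998, §19.2 Cor. 19.2] -/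
theorem cupProduct_mem_algebraicClasses_of_isRationalClass_of_inter
    (hX : Motives.IsSmoothProjective n X) {l k p : ℕ} (h : 2 * l + 2 * k = 2 * (p + 1))
    {Z W : Set X.left} (hZ : IsClosed Z) (hZl : ∀ z ∈ Z, (l : ℕ∞) ≤ Order.coheight z)
    (hW : IsClosed W) (hWk : ∀ w ∈ W, (k : ℕ∞) ≤ Order.coheight w)
    (hZW : ∀ t ∈ Z ∩ W, (p : ℕ∞) ≤ Order.coheight t)
    {a : complexBetti X (2 * l)} {b : complexBetti X (2 * k)} (ha : IsRationalClass a)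
    (ha0 : complexBetti.restrictCompl X Z (2 * l) a = 0) (hb : IsRationalClass b)
    (hb0 : complexBetti.restrictCompl X W (2 * k) b = 0) :
    cupProduct h a b ∈ algebraicClasses X (p + 1) := by
  classical
  -- the complex orientations and their Poincaré duality (a theorem)
  let μ : OrientationFamily :=
    fun _ _ hV ↦ Classical.choice (Motives.ComplexPoints.isOrientableOver ℂ hV)
  have hμ : μ.HasPoincareDuality := μ.hasPoincareDuality
  -- `a`, `b` are algebraic, hence Hodge classes; so is `a ∪ b`
  have haT : IsOfHodgeType n X (2 * l) l l a :=
    isOfHodgeType_of_mem_algebraicClasses_of_isSmoothProjective hX l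
      (mem_supportedClasses_of_restrictCompl_eq_zero hZ hZl ha0)
  have hbT : IsOfHodgeType n X (2 * k) k k b :=
    isOfHodgeType_of_mem_algebraicClasses_of_isSmoothProjective hX k
      (mem_supportedClasses_of_restrictCompl_eq_zero hW hWk hb0)
  have habT : IsOfHodgeType n X (2 * (p + 1)) (p + 1) (p + 1) (cupProduct h a b) := by
    have hlk : l + k = p + 1 := by omega
    have hT := cupPreservesHodgeType_of_multiplicative_deRham
      (fun E _ _ _ ↦ Literature.NumberTheory.Transcendental.exists_deRhamIsoFamily_holds E) hX h haT hbT
    rwa [hlk] at hT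
  -- `a ∪ b` is rational and dies off `Z ∩ W`, of codimension `≥ p`
  have habQ : IsRationalClass (cupProduct h a b) := ha.cup h hb
  have habS : cupProduct h a b ∈ supportedClasses X (2 * (p + 1)) p :=
    cupProduct_mem_supportedClasses_of_inter hZ hW hZW h ha0 hb0
  -- Voisin 2013, Lemma 2.1 (all inputs are theorems of the tree)
  exact mem_algebraicClasses_of_mem_supportedClasses_of_isOfHodgeType
    Deligne1974_ker_restrictCompl_eq_iSup_range_complexGysin_holds
    Voisin2025_hodgeClass_lift_complexGysin_holds (gysinMap_restrictCompl_eq_zero_of_field ℂ)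
    Resolution.Hironaka1964_projective_holds lefschetzOneOne_rational_holds μ hμ hX p habS habQ habT

/-! ### Bilinear extension to the coniveau spaces -/

/-- **`Nˡ H²ˡ ∪ Nᵏ H²ᵏ ⊆ Nᵖ⁺¹ H²ᵖ⁺²` on every smooth projective complex variety whenever `l + k = p + 1`
and `p ≤ max(l, k)`** — i.e. Voisin II Prop. 9.20 on the coniveau carrier in every bidegree with
`min(l, k) ≤ 1` (and, vacuously stronger, for `p < l + k − 1`), with no moving lemma. Both coniveau
spaces are sums of kernels `ker (H → H((X ∖ Z)(ℂ)))`, each the complex span of its RATIONAL classes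
(`span_isRationalClass_eq_top_of_isSmoothProjective_holds`, `ker_restrictCompl_le_span`); `∪` is
bilinear; and for rational generators the previous theorem applies, `Z ∩ W` having codimension
`≥ max(l, k) ≥ p`. [cite: VoisinHodgeII2003, §9.2.4 Prop. 9.20] [cite: Voisin2013GHCBloch, Lemma 2.1 (proof)]
[cite: GrothendieckTopology1969, pp. 299–300] -/
theorem cupProduct_mem_algebraicClasses_of_le_max (hX : Motives.IsSmoothProjective n X) {l k p : ℕ}
    (h : 2 * l + 2 * k = 2 * (p + 1)) (hp : p ≤ max l k) {a : complexBetti X (2 * l)}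
    {b : complexBetti X (2 * k)} (ha : a ∈ algebraicClasses X l) (hb : b ∈ algebraicClasses X k) :
    cupProduct h a b ∈ algebraicClasses X (p + 1) := by
  have hspan := span_isRationalClass_eq_top_of_isSmoothProjective_holds
  -- codimension of `Z ∩ W`
  have hcodim : ∀ ⦃Z W : Set X.left⦄, (∀ z ∈ Z, (l : ℕ∞) ≤ Order.coheight z) →
      (∀ w ∈ W, (k : ℕ∞) ≤ Order.coheight w) → ∀ t ∈ Z ∩ W, (p : ℕ∞) ≤ Order.coheight t := by
    intro Z W hZl hWk t ht
    rcases le_max_iff.1 hp with hpl | hpk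
    · exact le_trans (by exact_mod_cast hpl) (hZl t ht.1)
    · exact le_trans (by exact_mod_cast hpk) (hWk t ht.2)
  -- (A) for rational `b` dying off a closed `W` of codimension `≥ k`, every algebraic `a` works
  have hA : ∀ ⦃W : Set X.left⦄, IsClosed W → (∀ w ∈ W, (k : ℕ∞) ≤ Order.coheight w) →
      ∀ ⦃b : complexBetti X (2 * k)⦄, IsRationalClass b →
        complexBetti.restrictCompl X W (2 * k) b = 0 →
        algebraicClasses X l ≤ (algebraicClasses X (p + 1)).comap ((cupProduct h).flip b) := by
    intro W hW hWk b hb hb0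
    refine supportedClasses_le fun Z hZ hZl ↦ ?_
    refine (span_isRationalClass_eq_top_of_isSmoothProjective.ker_restrictCompl_le_span hspan hX Z
      (2 * l)).trans (Submodule.span_le.2 ?_)
    rintro a ⟨ha, ha0⟩
    rw [SetLike.mem_coe, Submodule.mem_comap, LinearMap.flip_apply]
    exact cupProduct_mem_algebraicClasses_of_isRationalClass_of_inter hX h hZ hZl hW hWk
      (hcodim hZl hWk) ha ha0 hb hb0
  -- (B) then every algebraic `b` works
  have hB : algebraicClasses X k ≤ (algebraicClasses X (p + 1)).comap (cupProduct h a) := by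
    refine supportedClasses_le fun W hW hWk ↦ ?_
    refine (span_isRationalClass_eq_top_of_isSmoothProjective.ker_restrictCompl_le_span hspan hX W
      (2 * k)).trans (Submodule.span_le.2 ?_)
    rintro b ⟨hb', hb0⟩
    have hab := hA hW hWk hb' hb0 ha
    rw [Submodule.mem_comap, LinearMap.flip_apply] at hab
    rw [SetLike.mem_coe, Submodule.mem_comap]
    exact hab
  exact Submodule.mem_comap.mp (hB hb)

/-- **Voisin II Prop. 9.20 for a cycle and a divisor, on every smooth projective complex variety:
`Nˡ H²ˡ ∪ N¹ H² ⊆ Nˡ⁺¹ H²ˡ⁺²`** ("`cl(Z · D) = cl(Z) ∪ cl(D)`"; in print the divisor moves in its linear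
system — here no moving at all: Deligne's Cor. 8.2.8, semisimplicity and Lefschetz `(1,1)`).
[cite: VoisinHodgeII2003, §9.2.4 Prop. 9.20] [cite: Voisin2013GHCBloch, Lemma 2.1 (proof)] -/
theorem cupProduct_mem_algebraicClasses_one_right (hX : Motives.IsSmoothProjective n X) {l : ℕ}
    {a : complexBetti X (2 * l)} {b : complexBetti X (2 * 1)} (ha : a ∈ algebraicClasses X l)
    (hb : b ∈ algebraicClasses X 1) :
    cupProduct (two_mul_add_two_mul l 1) a b ∈ algebraicClasses X (l + 1) :=
  cupProduct_mem_algebraicClasses_of_le_max hX _ (by omega) ha hb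

/-- **Voisin II Prop. 9.20 for a divisor and a cycle, on every smooth projective complex variety:
`N¹ H² ∪ Nᵏ H²ᵏ ⊆ N¹⁺ᵏ H²⁺²ᵏ`.** [cite: VoisinHodgeII2003, §9.2.4 Prop. 9.20]
[cite: Voisin2013GHCBloch, Lemma 2.1 (proof)] -/
theorem cupProduct_mem_algebraicClasses_one_left (hX : Motives.IsSmoothProjective n X) {k : ℕ}
    {a : complexBetti X (2 * 1)} {b : complexBetti X (2 * k)} (ha : a ∈ algebraicClasses X 1)
    (hb : b ∈ algebraicClasses X k) :
    cupProduct (two_mul_add_two_mul 1 k) a b ∈ algebraicClasses X (1 + k) := by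
  have hmem := cupProduct_mem_algebraicClasses_of_le_max hX
    (show 2 * 1 + 2 * k = 2 * (k + 1) by omega) (by omega) ha hb
  exact (cupProduct_mem_supportedClasses_congr _ _ (Nat.add_comm k 1) a b).mp hmem

/-- **Every bidegree with `min(l, k) ≤ 1`**: for `X` smooth projective over `ℂ`, `a ∈ Nˡ H²ˡ`,
`b ∈ Nᵏ H²ᵏ` and `l ≤ 1 ∨ k ≤ 1`, `a ∪ b ∈ Nˡ⁺ᵏ H²ˡ⁺²ᵏ` (the cases `l = 0`, `k = 0` included; they are
also the tree's `cupProduct_mem_algebraicClasses_zero_left/right`). What is left of the named fact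
`Voisin2003_cupProduct_algebraicClasses` is `2 ≤ l`, `2 ≤ k` (and `l + k < dim X`,
`AlgebraicClassesCupOffRange`). [cite: VoisinHodgeII2003, §9.2.4 Prop. 9.20] [cite: Voisin2013GHCBloch, Lemma 2.1 (proof)] -/
theorem cupProduct_mem_algebraicClasses_of_min_le_one (hX : Motives.IsSmoothProjective n X)
    {l k : ℕ} (hlk : l ≤ 1 ∨ k ≤ 1) {a : complexBetti X (2 * l)} {b : complexBetti X (2 * k)}
    (ha : a ∈ algebraicClasses X l) (hb : b ∈ algebraicClasses X k) :
    cupProduct (two_mul_add_two_mul l k) a b ∈ algebraicClasses X (l + k) := by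
  rcases Nat.eq_zero_or_pos (l + k) with h0 | hpos
  · -- `l = k = 0`: everything is `N⁰ = ⊤`
    obtain ⟨rfl, rfl⟩ : l = 0 ∧ k = 0 := by omega
    have htop : supportedClasses X (2 * (0 + 0)) (0 + 0) = ⊤ := supportedClasses_zero X _
    change cupProduct (two_mul_add_two_mul 0 0) a b ∈ supportedClasses X (2 * (0 + 0)) (0 + 0)
    rw [htop]
    exact Submodule.mem_top
  · obtain ⟨p, hp⟩ : ∃ p, l + k = p + 1 := ⟨l + k - 1, by omega⟩
    have hmem := cupProduct_mem_algebraicClasses_of_le_max hX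
      (show 2 * l + 2 * k = 2 * (p + 1) by omega) (by rcases hlk with h | h <;> omega) ha hb
    exact (cupProduct_mem_supportedClasses_congr _ _ hp.symm a b).mp hmem

/-! ### The Lefschetz operator of any divisor class preserves algebraic classes -/

/-- **`L_h (Nˡ Hⁱ) ⊆ Nˡ⁺¹ Hⁱ⁺²` (`i = 2l`) for EVERY class `h ∈ N¹ H²(X(ℂ); ℂ)`** on a smooth projective
complex `X`, in an arbitrary spelling `m` of the target degree `2 + i` ("`[Z] ↦ [H] ∪ [Z] = [H · Z]`",
Voisin II Prop. 9.20 with a divisor; the case `(1, l)` of `cupProduct_mem_algebraicClasses_of_le_max`,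
transported along the degree equations). [cite: VoisinHodgeII2003, §9.2.4 Prop. 9.20] [cite: Fulton1998, §19.2 Cor. 19.2] -/
theorem lefschetzOperator_mem_supportedClasses_of_mem (hX : Motives.IsSmoothProjective n X)
    {h : complexBetti X 2} (hh : h ∈ algebraicClasses X 1) {i m : ℕ} (l : ℕ) (hi : i = 2 * l)
    (hm : 2 + i = m) {c : complexBetti X i} (hc : c ∈ supportedClasses X i l) :
    lefschetzOperator h hm c ∈ supportedClasses X m (l + 1) := by
  subst hi
  subst hm
  rw [lefschetzOperator_apply]
  have hmem := cupProduct_mem_algebraicClasses_of_le_max hX (l := 1) (k := l) (p := l)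
    (show 2 * 1 + 2 * l = 2 * (l + 1) by omega) (by omega) hh hc
  exact (cupProduct_mem_supportedClasses_iff _ _ (l + 1) h c).mp hmem

/-- **`L_h (Nˡ H²ˡ) ⊆ Nˡ⁺¹ H²ˡ⁺²` for EVERY class `h ∈ N¹ H²(X(ℂ); ℂ)`** on a smooth projective complex
`X` (the field `HardLefschetzNFold.lefschetzOperator_mem_algebraicClasses`, proved in the tree for
classes supported on every hypersurface section,
`lefschetzOperator_mem_algebraicClasses_of_forall_hypersurfaceSection`; here for all divisor classes,
with no moving). [cite: VoisinHodgeII2003, §9.2.4 Prop. 9.20] [cite: Fulton1998, §19.2 Cor. 19.2] -/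
theorem lefschetzOperator_mem_algebraicClasses_of_mem (hX : Motives.IsSmoothProjective n X)
    {h : complexBetti X 2} (hh : h ∈ algebraicClasses X 1) (l : ℕ) {c : complexBetti X (2 * l)}
    (hc : c ∈ algebraicClasses X l) :
    lefschetzOperator h (two_add_two_mul l) c ∈ algebraicClasses X (l + 1) :=
  lefschetzOperator_mem_supportedClasses_of_mem hX hh l rfl (two_add_two_mul l) hc

/-- **The iterated Lefschetz operator of a divisor class preserves algebraic classes:
`Lʲ_h (Nˡ H²ˡ) ⊆ Nˡ⁺ʲ H²ˡ⁺²ʲ`** for every `h ∈ N¹ H²(X(ℂ); ℂ)` (induction on `j`, in the degree spelling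
`2l + 2j` of `lefschetzPow`). In particular the powers of a polarisation class and the Lefschetz maps
`Lʲ` send algebraic classes to algebraic classes on every smooth projective complex variety.
[cite: VoisinHodgeII2003, §9.2.4 Prop. 9.20] [cite: Fulton1998, §19.2 Cor. 19.2] -/
theorem lefschetzPow_mem_supportedClasses_of_mem (hX : Motives.IsSmoothProjective n X)
    {h : complexBetti X 2} (hh : h ∈ algebraicClasses X 1) (l : ℕ) {c : complexBetti X (2 * l)}
    (hc : c ∈ algebraicClasses X l) (j : ℕ) :
    lefschetzPow h j (2 * l) c ∈ supportedClasses X (2 * l + 2 * j) (l + j) := by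
  induction j with
  | zero => simpa [lefschetzPow] using hc
  | succ j ih =>
    change lefschetzOperator h _ (lefschetzPow h j (2 * l) c) ∈
      supportedClasses X (2 * l + 2 * (j + 1)) (l + j + 1)
    exact lefschetzOperator_mem_supportedClasses_of_mem hX hh (l + j) (two_mul_add_two_mul l j) _ ih

end HodgeTheory

end Literature.AlgebraicGeometry.HodgeTheory

end
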